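import Summits.QuantumFields.BalabanUV.T4Continuum.Support.NE7EtaSupFromEnergyTorus
import Summits.QuantumFields.BalabanUV.T4Continuum.Support.NE7EtaPlaquetteCloseness

/-!
# NE7EtaPlaquetteClosenessTorus — route #1 of the NE7 crux, hardest stub S1∕L7b: the CAPSTONE display at `d = 4` —
# every plaquette of run A's gauge-fixed minimiser is within `2a′²b′ + 24(e^{sξ^k} − 1)·2a²b` of the corresponding plaquette of the
# once-averaged run-B minimiser, from row NE3's root (energy conjunct; sup conjunct only in the exponential) + step-Lipschitz conjuncts,
# with the cube sides OPTIMISED IN THE KERNEL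

Cell `pub-balaban`, rung (B)+1 sub-cell t4, lineage `b2b-balaban-t4-ne7-p1`, generation 21 (CRUX PROVER NE7 #1, ruling e34b3e0c); crux
skeleton `t4/skeletons/NE7-CRUX-R1.md` v1.5 §3bis; sequel of `NE7EtaSupFromEnergy` (p249485), `NE7EtaPlaquetteCloseness` (p249813),
`NE7EtaSupFromEnergyTorus` (p250077).  HONEST FRAMING (page 1): FIXED FINITE T⁴, rung (B)+1; NE7, NE3 NOT PRINTED in
[Balaban1984PropagatorsI]–[Balaban1989LargeFieldII] and NOT PROVED here; continuum YM on T⁴ ⇐ BetaPertH ∧ nine spine estimates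
(0/9 proved); BetaPertH ⇐ (D1) ∧ (D4) ∧ CAP+tail; G-an2-4 gates asym, D1 and NE2/3/4; NOT infinite volume, NOT mass gap, NOT Clay.

THE DISPLAY (`plaquette_closeness_opt_d4`).  `d = 4`, `L, N ≥ 1`, row NE3's root T-E_w♯ `NE3EnergyRateWSup 4 𝒞 L N b g C s dom`; `k ≥ 1`,
`V ∈ dom`, `UA` a run-A minimiser (level `k`), `UB` a REGULAR run-B minimiser (level `k+1`) whose once-averaged configuration
`W = rescale L (bavg L UB)` is unitary and `N L^k`-periodic (one-run facts, displayed).  Then the root's representation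
`gaugeAct u UA = vary W Z 1` satisfies, for every plaquette `p = (z; μ < ν)`, every step-Lipschitz constants `λ` (all `Z(·, κ)`), `λ′`
(`(d_W Z)(·; μ < ν)`) the pair happens to have, and every `a, b, a′, b′ > 0` with `8λ ≤ a³`, `L^k·C·R_k ≤ b³`, `8λ′ ≤ a′³`, `C·R_k ≤ b′³`
(`R_k = residualScale 4 L N b g k`) whose optimal cubes fit (`b∕a + 1 ≤ N L^k`, `b′∕a′ + 1 ≤ N L^k`):
  `‖(gaugeAct u UA)(∂p) − W(∂p)‖ ≤ 2a′²b′ + 6(e^{s(L⁻¹)^k} − 1)·(4·(2a²b))`.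
READING (ξ = L^{−k}; prose): `λ′ = Λ₂ξ³`, `C·R_k ≈ cN²√g·ξ` ⇒ `2a′²b′ = 8Λ₂^{2/3}(cN²√g)^{1/3}·ξ^{7/3}`; `λ = Λ₁ξ²`, `L^k·C·R_k ≈ cN²√g` ⇒
`2a²b = 8Λ₁^{2/3}(cN²√g)^{1/3}·ξ^{4/3}` and `6(e^{sξ^k} − 1) ≈ 6sξ^k`, second term `≈ 192·s·Λ₁^{2/3}(cN²√g)^{1/3}·ξ^{7/3}`: BOTH one
third of a power below the (1.15) margin `βα₀(g_k)ξ²` — route #1's U-slot closeness for the curvature coordinate at GEOMETRIC rate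
`L^{−1/3}` (times poly∕log(α₀(g_k))), CONDITIONAL on row NE3's T-E_w + (Lip₁)(Lip₂) (the re-typed INTERFACE REQUEST NE7→NE3) and on
NODE O's carrier reading the U-slot through plaquette variables.  The (1.16) derivative coordinate needs one more conjunct (Lip₃) and a
discrete Landau–Kolmogorov step (rate `L^{−1/6}`; NOT done here).  [folklore] composition; 0 def; 0 sorry.
-/

set_option autoImplicit false

open scoped BigOperators Matrix Matrix.Norms.L2Operator
open Finset

namespace Summit.QuantumFields.BalabanUV.T4Continuum.NE7EtaPlaquetteClosenessTorus

open Literature.MathematicalPhysics.QuantumFieldTheory.Balaban1983to89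
open B7Prop1Explicit B7Prop2Explicit
open T4AveragingDeficitWall hiding Site Plane Plaq Bond
open T4AveragingDeficitWallBoundary (periodBox IsPeriodicCfg)
open AveragingDeficitPeriodicCounting (IsPeriodicDir)
open MinimalActionSandwich (IsMinimiser)
open MinimalActionRate (Regular)
open NE3EnergyShapes (residualScale residualScale_nonneg IsUnitarySite IsPeriodicSite)
open NE3EnergyWeightedShapes (energyNormW energyNormW_nonneg)
open NE3EnergyWeightedSupShape (NE3EnergyRateWSup)
open NE3HessContinuity (bondL1At bondL1At_nonneg)
open NE3EnergySmallFieldCurl (norm_hol_vary_sub_hol_le_curl)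
open NE7EtaSupFromEnergyTorus (exists_side_two_term sqrt_pow_four norm_dir_le_of_energyNormW_periodic
  norm_curl_le_of_energyNormW_periodic)

noncomputable section

variable {n : Type*} [Fintype n] [DecidableEq n]

/-- **OPTIMISED BOUND FROM A TWO-TERM FAMILY WITH AN UPPER BOUND ON THE ENERGY TERM** (`d = 4`): if `8λ ≤ a³`, `B ≤ b³`
(`a, b > 0`) and `b∕a + 1 ≤ P`, then any quantity bounded by `8rλ + B∕√((r+1)⁴)` for every cube side `r ≤ P − 1` is `≤ 2a²b`.
(The arithmetic shared by the two coordinates; `exists_side_two_term`.) [folklore] -/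
theorem le_opt_of_two_term {lam B a b v : ℝ} {P : ℕ} (ha : 0 < a) (hb : 0 < b) (ha3 : 8 * lam ≤ a ^ 3) (hB : B ≤ b ^ 3)
    (hfit : b / a + 1 ≤ P) (hv : ∀ r : ℕ, r + 1 ≤ P → v ≤ 8 * r * lam + B / Real.sqrt (((r : ℝ) + 1) ^ 4)) :
    v ≤ 2 * a ^ 2 * b := by
  obtain ⟨r, hr1, hr2⟩ := exists_side_two_term ha hb
  have hrP : r + 1 ≤ P := by
    have : (r : ℝ) + 1 < (P : ℝ) := lt_of_lt_of_le hr1 hfit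
    exact_mod_cast this.le
  have h := hv r hrP
  rw [sqrt_pow_four] at h
  have hr0 : (0 : ℝ) ≤ r := Nat.cast_nonneg r
  have hpos : 0 < ((r : ℝ) + 1) ^ 2 := by positivity
  have h1 : 8 * (r : ℝ) * lam ≤ a ^ 3 * r := by
    have := mul_le_mul_of_nonneg_right ha3 hr0
    linarith
  have h2 : B / ((r : ℝ) + 1) ^ 2 ≤ b ^ 3 / ((r : ℝ) + 1) ^ 2 := div_le_div_of_nonneg_right hB hpos.le
  linarith

/-- **THE CAPSTONE DISPLAY AT `d = 4`** (module docstring). [folklore] -/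
theorem plaquette_closeness_opt_d4 [Nonempty n] {𝒞 : ℕ → Set (Site 4 → Fin 4 → (Matrix n n ℂ)ˣ)} {L N : ℕ} (hL : 1 ≤ L)
    (hN : 1 ≤ N) {b g C s : ℝ} {dom : Set (Site 4 → Fin 4 → (Matrix n n ℂ)ˣ)} (h : NE3EnergyRateWSup 4 𝒞 L N b g C s dom)
    {k : ℕ} (hk : 1 ≤ k) {V : Site 4 → Fin 4 → (Matrix n n ℂ)ˣ} (hV : V ∈ dom)
    {UA UB : Site 4 → Fin 4 → (Matrix n n ℂ)ˣ} (hA : IsMinimiser 4 𝒞 L N k V UA) (hB : IsMinimiser 4 𝒞 L N (k + 1) V UB)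
    (hreg : Regular 4 L N b g (k + 1) UB) (hWu : IsUnitaryCfg (rescale L (bavg L UB)))
    (hWP : IsPeriodicCfg (rescale L (bavg L UB)) ((N * L ^ k : ℕ) : ℤ)) :
    ∃ (u : Site 4 → (Matrix n n ℂ)ˣ) (Z : Site 4 → Fin 4 → Matrix n n ℂ),
      IsUnitarySite u ∧ IsPeriodicSite u ((N * L ^ k : ℕ) : ℤ) ∧ IsSkewDir Z ∧ IsPeriodicDir Z ((N * L ^ k : ℕ) : ℤ) ∧
      gaugeAct u UA = vary (rescale L (bavg L UB)) Z 1 ∧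
      ∀ (z : Site 4) (μ ν : Fin 4) (hμν : μ < ν) (lam lam' : ℝ), 0 ≤ lam → 0 ≤ lam' →
        (∀ (κ : Fin 4) (x : Site 4) (ρ : Fin 4), ‖Z (x + e ρ) κ - Z x κ‖ ≤ lam) →
        (∀ (x : Site 4) (ρ : Fin 4),
          ‖curl (rescale L (bavg L UB)) Z (x + e ρ, ⟨(μ, ν), hμν⟩) - curl (rescale L (bavg L UB)) Z (x, ⟨(μ, ν), hμν⟩)‖ ≤ lam') →
        ∀ (a b' a' bb : ℝ), 0 < a → 0 < bb → 0 < a' → 0 < b' →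
          8 * lam ≤ a ^ 3 → (L : ℝ) ^ k * (C * residualScale 4 L N b g k) ≤ bb ^ 3 →
          8 * lam' ≤ a' ^ 3 → C * residualScale 4 L N b g k ≤ b' ^ 3 →
          bb / a + 1 ≤ (N * L ^ k : ℕ) → b' / a' + 1 ≤ (N * L ^ k : ℕ) →
          ‖((hol (gaugeAct u UA) z (plaqWord μ ν) : (Matrix n n ℂ)ˣ) : Matrix n n ℂ)
              - ((hol (rescale L (bavg L UB)) z (plaqWord μ ν) : (Matrix n n ℂ)ˣ) : Matrix n n ℂ)‖
            ≤ 2 * a' ^ 2 * b' + 6 * (Real.exp (s * ((L : ℝ)⁻¹) ^ k) - 1) * (4 * (2 * a ^ 2 * bb)) := by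
  obtain ⟨u, Z, hu, huP, hZ, hZP, hrep, hE, hsup⟩ := h k hk V hV UA UB hA hB hreg
  refine ⟨u, Z, hu, huP, hZ, hZP, hrep, ?_⟩
  intro z μ ν hμν lam lam' hlam hlam' hlip hlip' a b' a' bb ha hbb ha' hb' ha3 hbb3 ha3' hb3' hfit hfit'
  rw [hrep]
  set W := rescale L (bavg L UB) with hWdef
  set P : ℕ := N * L ^ k with hPdef
  have hP : 1 ≤ P := Nat.one_le_iff_ne_zero.mpr (Nat.mul_ne_zero (by omega) (pow_ne_zero k (by omega)))
  set E := energyNormW L k W Z (periodBox (d := 4) P) with hEdef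
  have hE0 : 0 ≤ E := energyNormW_nonneg L k W Z _
  have hER : E ≤ C * residualScale 4 L N b g k := hE
  have hLk : 0 ≤ (L : ℝ) ^ k := pow_nonneg (Nat.cast_nonneg L) k
  -- the NE3 crew's one-configuration calculus at t = 1
  have h0 := norm_hol_vary_sub_hol_le_curl hWu hZ hsup (t := (1 : ℝ)) zero_le_one z μ ν
  rw [one_mul, one_mul] at h0
  -- the dressed curl: optimised pointwise bound with the upper bound b'³ on the energy
  have hcurl : ‖curlAt W Z z μ ν‖ ≤ 2 * a' ^ 2 * b' := by
    refine le_opt_of_two_term (B := E) ha' hb' ha3' (hER.trans hb3') hfit' fun r hr => ?_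
    have h' := norm_curl_le_of_energyNormW_periodic L k hP hWP hZP ⟨(μ, ν), hμν⟩ hlam' hlip' z hr
    have e1 : curl W Z (z, ⟨(μ, ν), hμν⟩) = curlAt W Z z μ ν := rfl
    rw [e1] at h'
    push_cast at h'
    linarith
  -- the four bonds of ∂p: optimised pointwise bound with the upper bound bb³ on L^k·energy
  have hdir : ∀ (x : Site 4) (κ : Fin 4), ‖Z x κ‖ ≤ 2 * a ^ 2 * bb := by
    intro x κ
    refine le_opt_of_two_term (B := (L : ℝ) ^ k * E) ha hbb ha3 ((mul_le_mul_of_nonneg_left hER hLk).trans hbb3) hfit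
      fun r hr => ?_
    have h' := norm_dir_le_of_energyNormW_periodic hL k hP hWP hZP κ hlam (hlip κ) x hr
    push_cast at h'
    linarith
  have hL1 : bondL1At Z z μ ν ≤ 4 * (2 * a ^ 2 * bb) := by
    unfold bondL1At
    have := hdir z μ; have := hdir (z + e μ) ν; have := hdir (z + e ν) μ; have := hdir z ν
    linarith
  have hα0 : 0 ≤ s * ((L : ℝ)⁻¹) ^ k := (norm_nonneg _).trans (hsup z μ)
  have hexp : 0 ≤ 6 * (Real.exp (s * ((L : ℝ)⁻¹) ^ k) - 1) := by
    have := Real.add_one_le_exp (s * ((L : ℝ)⁻¹) ^ k); nlinarith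
  have h2 : 6 * (Real.exp (s * ((L : ℝ)⁻¹) ^ k) - 1) * bondL1At Z z μ ν
      ≤ 6 * (Real.exp (s * ((L : ℝ)⁻¹) ^ k) - 1) * (4 * (2 * a ^ 2 * bb)) := mul_le_mul_of_nonneg_left hL1 hexp
  linarith

end

end Summit.QuantumFields.BalabanUV.T4Continuum.NE7EtaPlaquetteClosenessTorus
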